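import Summits.ABC.StewartYu.PadicW80Par3B
import HarnessLib

/-!
# The `q = 3` (`p = 2`) parameter record — part C: the level arithmetic and **KT₃**
# (`kpts · t_J ∈ [(31/32)·(8/3), 8/3] · 3ᵏ · 𝔘/ℓ`)

Support file (theorems only; no named facts), cell `abc-stewartyu` (p1; crux `W80Two` stmt-ABC-19486; design memo
HOME/p1/S2-q3-record-design.md).  Base-`3` twin of `PadicW80ParLC` (the products `S₀ Lⱼ Vⱼ`, `L_θ S₀`) and
`PadicW80ParLD` (the level arithmetic `3ᴶ ≤ L_θ`, `T/3ᴶ ≥ 2¹¹ m²`, `1 ≤ t_J`, the room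
`⌊T/3^{J+1}⌋ + (d+1) t_J ≤ ⌊T/3ᴶ⌋` for the `d` TRIPLING inner steps and the third step, the node counts
`kpts = #{s < 3^{k+J} S₀ : 3 ∤ s}`, and the product bounds **`KT3_le` / `KT3_ge`**: with `c_S/c_T = 2`,
`(31/32)·(8/3)·3ᵏ 𝔘/ℓ ≤ kpts · t_J ≤ (8/3)·3ᵏ 𝔘/ℓ` — the Schwarz exponent of the `k`-th inner step
(`k = d`: the third step) grows like `3ᵏ`, matching the third-step Liouville exponent `≍ 3^{d+2}`).
Everything is [folklore] bookkeeping on [cite: Waldschmidt1980, Lemma 3.5–3.6 (pp. 271–272)] and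
[cite: Yu1989, §3 Lemma 3.3].
-/

noncomputable section

open Finset Real

namespace Summit.ABC.StewartYu

open PadicW80Par (cTp cSp cLp cLp' Ap mRp)

namespace PadicW80ParL

variable {d : ℕ} (P : PadicW80ParL d)

/-! ### The products `S₀ Lⱼ Vⱼ`, `L_θ S₀` -/

/-- `S₀ Lⱼ Vⱼ ≤ 𝔘/(3 c_L' m)`. [cite: Waldschmidt1980, (3.11) (p. 265)] -/
theorem S₀3L3V_le (j : Fin d) : (P.S₀3 : ℝ) * (P.L3 j * P.V j) ≤ P.𝔘3 / (3 * cLp' * mRp d) := by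
  have h := P.L3_le j
  have hden := P.den_L3_pos j
  have hS := P.S₀3_pos; have hV := P.hV j; have hm := mR_pos P
  rw [le_div_iff₀ hden, P.U_eq3] at h
  rw [le_div_iff₀ (by unfold cLp'; positivity)]
  have e : (P.L3 j : ℝ) * (cLp' * mRp d * 3 ^ (d + 2) * P.S₀3 * P.V j) =
      P.S₀3 * (P.L3 j * P.V j) * (3 * cLp' * mRp d) * 3 ^ (d + 1) := by rw [pow_succ]; ring
  rw [e] at h
  have h3 : (0 : ℝ) < 3 ^ (d + 1) := by positivity
  have h' : P.S₀3 * (P.L3 j * P.V j) * (3 * cLp' * mRp d) * 3 ^ (d + 1) ≤ P.𝔘3 * 3 ^ (d + 1) := by linarith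
  exact le_of_mul_le_mul_right h' h3

/-- `S₀ L_θ V_θ ≤ 𝔘/(3 c_L' m)`. [cite: Waldschmidt1980, (3.11) (p. 265)] -/
theorem S₀3Lθ3Vθ_le : (P.S₀3 : ℝ) * (P.Lθ3 * P.Vθ) ≤ P.𝔘3 / (3 * cLp' * mRp d) := by
  have h := P.Lθ3_le
  have hden := P.den_Lθ3_pos
  have hS := P.S₀3_pos; have hV := P.hVθ1; have hm := mR_pos P
  rw [le_div_iff₀ hden, P.U_eq3] at h
  rw [le_div_iff₀ (by unfold cLp'; positivity)]
  have e : (P.Lθ3 : ℝ) * (cLp' * mRp d * 3 ^ (d + 2) * P.S₀3 * P.Vθ) =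
      P.S₀3 * (P.Lθ3 * P.Vθ) * (3 * cLp' * mRp d) * 3 ^ (d + 1) := by rw [pow_succ]; ring
  rw [e] at h
  have h3 : (0 : ℝ) < 3 ^ (d + 1) := by positivity
  have h' : P.S₀3 * (P.Lθ3 * P.Vθ) * (3 * cLp' * mRp d) * 3 ^ (d + 1) ≤ P.𝔘3 * 3 ^ (d + 1) := by linarith
  exact le_of_mul_le_mul_right h' h3

/-- **`S₀ (∑ LⱼVⱼ + L_θV_θ) ≤ 𝔘/(3 c_L')`** ((3.11) at the `2`-adic parameters). [cite: Waldschmidt1980, (3.11) (p. 265)] -/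
theorem S₀3LV_le : (P.S₀3 : ℝ) * ((∑ j, P.L3 j * P.V j) + P.Lθ3 * P.Vθ) ≤ P.𝔘3 / (3 * cLp') := by
  have h1 := P.S₀3L3V_le; have h2 := P.S₀3Lθ3Vθ_le
  have hm := mR_pos P
  rw [mul_add, mul_sum]
  calc (∑ j, (P.S₀3 : ℝ) * (P.L3 j * P.V j)) + P.S₀3 * (P.Lθ3 * P.Vθ)
      ≤ (∑ _j : Fin d, P.𝔘3 / (3 * cLp' * mRp d)) + P.𝔘3 / (3 * cLp' * mRp d) := add_le_add (sum_le_sum fun j _ => h1 j) h2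
    _ = (d + 1) * (P.𝔘3 / (3 * cLp' * mRp d)) := by rw [sum_const, card_univ, Fintype.card_fin]; simp; ring
    _ = P.𝔘3 / (3 * cLp') := by unfold mRp cLp'; field_simp

/-- `L_θ S₀ ≤ 𝔘/2¹⁴` (`V_θ ≥ 1`, `m ≥ 2`, `3 c_L' m ≥ 2¹⁴`). [folklore] -/
theorem Lθ3S₀3_le : (P.Lθ3 : ℝ) * P.S₀3 ≤ P.𝔘3 / 2 ^ 14 := by
  have h := P.S₀3Lθ3Vθ_le
  have hV := P.hVθ1; have hm := two_le_mR P; have hS := P.S₀3_pos; have hU := P.𝔘3_pos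
  have hL : (0 : ℝ) ≤ P.Lθ3 := Nat.cast_nonneg _
  unfold cLp' at h
  rw [le_div_iff₀ (by positivity)] at h
  rw [le_div_iff₀ (by positivity)]
  have h2 : (P.Lθ3 : ℝ) * P.S₀3 * (2 ^ 14) ≤ P.S₀3 * (P.Lθ3 * P.Vθ) * (3 * 2 ^ 12 * mRp d) := by
    calc (P.Lθ3 : ℝ) * P.S₀3 * 2 ^ 14 ≤ (P.Lθ3 * P.S₀3 * 1) * (3 * 2 ^ 12 * 2) := by nlinarith
      _ ≤ (P.Lθ3 * P.S₀3 * P.Vθ) * (3 * 2 ^ 12 * mRp d) := by gcongr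
      _ = P.S₀3 * (P.Lθ3 * P.Vθ) * (3 * 2 ^ 12 * mRp d) := by ring
  linarith

/-- `L_θ S₀ ℓ ≤ 𝔘/2¹⁴` (the floor `V_θ ≥ ℓ`). [folklore] -/
theorem Lθ3S₀3ℓ_le : (P.Lθ3 : ℝ) * P.S₀3 * P.ℓ ≤ P.𝔘3 / 2 ^ 14 := by
  have h := P.S₀3Lθ3Vθ_le
  have hV := P.hVθℓ; have hm := two_le_mR P; have hS := P.S₀3_pos; have hU := P.𝔘3_pos; have hℓ := P.ℓ_pos
  have hL : (0 : ℝ) ≤ P.Lθ3 := Nat.cast_nonneg _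
  unfold cLp' at h
  rw [le_div_iff₀ (by positivity)] at h
  rw [le_div_iff₀ (by positivity)]
  have hVθ0 : (0 : ℝ) ≤ P.Vθ := le_trans zero_le_one P.hVθ1
  have hLS0 : (0 : ℝ) ≤ P.Lθ3 * P.S₀3 := by positivity
  have h2 : (P.Lθ3 : ℝ) * P.S₀3 * P.ℓ * (2 ^ 14) ≤ P.S₀3 * (P.Lθ3 * P.Vθ) * (3 * 2 ^ 12 * mRp d) := by
    calc (P.Lθ3 : ℝ) * P.S₀3 * P.ℓ * 2 ^ 14 ≤ (P.Lθ3 * P.S₀3 * P.ℓ) * (3 * 2 ^ 12 * 2) := by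
          have : (0 : ℝ) ≤ P.Lθ3 * P.S₀3 * P.ℓ := by positivity
          nlinarith
      _ ≤ (P.Lθ3 * P.S₀3 * P.Vθ) * (3 * 2 ^ 12 * mRp d) :=
          mul_le_mul (mul_le_mul_of_nonneg_left hV hLS0) (by nlinarith) (by positivity)
            (mul_nonneg hLS0 hVθ0)
      _ = P.S₀3 * (P.Lθ3 * P.Vθ) * (3 * 2 ^ 12 * mRp d) := by ring
  linarith

/-! ### The level arithmetic -/

/-- For `J < J₀`, `3ᴶ ≤ L_θ`. [folklore] -/
theorem three_pow_le_Lθ3 {J : ℕ} (hJ : J < P.J₀3) : 3 ^ J ≤ P.Lθ3 := by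
  have h := P.three_pow_le
  have : 3 ^ (J + 1) ≤ 3 ^ P.J₀3 := Nat.pow_le_pow_right (by norm_num) hJ
  rw [pow_succ] at this
  omega

/-- **`⌊T/3ᴶ⌋ ≥ 2¹¹ m²`** for `J < J₀` (`T ≥ 2¹¹ m² nV_θ L_θ ≥ 2¹¹ m² 3ᴶ`). [folklore] -/
theorem TJ3_ge {J : ℕ} (hJ : J < P.J₀3) : 2 ^ 11 * (d + 1) ^ 2 ≤ P.T3 / 3 ^ J := by
  rw [Nat.le_div_iff_mul_le (Nat.pow_pos (by norm_num))]
  have h := P.T3_ge_Lθ3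
  have hL := P.three_pow_le_Lθ3 hJ
  have hV := P.one_le_nVθ
  have : ((2 ^ 11 * (d + 1) ^ 2 * 3 ^ J : ℕ) : ℝ) ≤ P.T3 := by
    refine le_trans ?_ h
    have hL' : ((3 : ℝ) ^ J) ≤ P.Lθ3 := by exact_mod_cast hL
    have e : ((2 ^ 11 * (d + 1) ^ 2 * 3 ^ J : ℕ) : ℝ) = 2 ^ 11 * mRp d ^ 2 * 3 ^ J := by
      unfold mRp; push_cast; ring
    rw [e]
    have h0 : (0 : ℝ) ≤ 2 ^ 11 * mRp d ^ 2 := by positivity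
    calc (2 : ℝ) ^ 11 * mRp d ^ 2 * 3 ^ J = 2 ^ 11 * mRp d ^ 2 * 1 * 3 ^ J := by ring
      _ ≤ 2 ^ 11 * mRp d ^ 2 * P.nVθ * P.Lθ3 :=
          mul_le_mul (mul_le_mul_of_nonneg_left hV h0) hL' (by positivity) (mul_nonneg h0 (by linarith))
  exact_mod_cast this

/-- `⌊T/3^{J+1}⌋ ≥ 2⁹ m²` for `J < J₀`. [folklore] -/
theorem TJ3_succ_ge {J : ℕ} (hJ : J < P.J₀3) : 2 ^ 9 * (d + 1) ^ 2 ≤ P.T3 / 3 ^ (J + 1) := by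
  have h := P.TJ3_ge hJ
  rw [show (3 : ℕ) ^ (J + 1) = 3 ^ J * 3 from pow_succ 3 J, ← Nat.div_div_eq_div_mul]
  omega

/-- `1 ≤ t_J` for `J < J₀`. [folklore] -/
theorem one_le_tJ3 {J : ℕ} (hJ : J < P.J₀3) : 1 ≤ P.tJ3 J := by
  unfold tJ3
  rw [Nat.le_div_iff_mul_le (by omega)]
  have := P.TJ3_succ_ge hJ
  nlinarith

/-- `(d+1) · t_J ≤ 2 ⌊T/3^{J+1}⌋`. [folklore] -/
theorem tJ3_mul_le (J : ℕ) : (d + 1) * P.tJ3 J ≤ 2 * (P.T3 / 3 ^ (J + 1)) := by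
  unfold tJ3; rw [Nat.mul_comm]; exact Nat.div_mul_le_self _ _

/-- **The room of level `J`**: `⌊T/3^{J+1}⌋ + (d+1)·t_J ≤ ⌊T/3ᴶ⌋` — `d` tripling inner steps and the third
step, each of multiplicity `t_J`, leave the `⌊T/3^{J+1}⌋` derivatives of level `J+1`. [cite: Yu1989, §3] -/
theorem room3 (J : ℕ) : P.T3 / 3 ^ (J + 1) + (d + 1) * P.tJ3 J ≤ P.T3 / 3 ^ J := by
  have h := P.tJ3_mul_le J
  have h3 : 3 * (P.T3 / 3 ^ (J + 1)) ≤ P.T3 / 3 ^ J := by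
    rw [show (3 : ℕ) ^ (J + 1) = 3 ^ J * 3 from pow_succ 3 J, ← Nat.div_div_eq_div_mul, Nat.mul_comm]
    exact Nat.div_mul_le_self _ _
  omega

/-- `t_J ≤ T`. [folklore] -/
theorem tJ3_le_T3 (J : ℕ) : P.tJ3 J ≤ P.T3 := by
  have h := P.tJ3_mul_le J
  have h2 : P.T3 / 3 ^ (J + 1) ≤ P.T3 / 3 := Nat.div_le_div_left (by
    calc 3 = 3 ^ 1 := (pow_one 3).symm
      _ ≤ 3 ^ (J + 1) := Nat.pow_le_pow_right (by norm_num) (by omega)) (by norm_num)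
  have h3 : 2 * (P.T3 / 3) ≤ P.T3 := by omega
  have hd : P.tJ3 J ≤ (d + 1) * P.tJ3 J := Nat.le_mul_of_pos_left _ (by omega)
  omega

/-- `t_J ≤ 2T/(3^{J+1} · m)` (real). [folklore] -/
theorem tJ3_le_real (J : ℕ) : (P.tJ3 J : ℝ) ≤ 2 * P.T3 / (3 ^ (J + 1) * mRp d) := by
  have h1 : ((P.tJ3 J : ℕ) : ℝ) ≤ ((2 * (P.T3 / 3 ^ (J + 1)) : ℕ) : ℝ) / mRp d := by
    unfold tJ3
    have := Nat.cast_div_le (α := ℝ) (m := 2 * (P.T3 / 3 ^ (J + 1))) (n := d + 1)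
    have em : ((d + 1 : ℕ) : ℝ) = mRp d := by unfold mRp; push_cast; ring
    rwa [em] at this
  have h2 : ((2 * (P.T3 / 3 ^ (J + 1)) : ℕ) : ℝ) ≤ 2 * ((P.T3 : ℝ) / 3 ^ (J + 1)) := by
    have := Nat.cast_div_le (α := ℝ) (m := P.T3) (n := 3 ^ (J + 1))
    push_cast at this ⊢; linarith
  have hm := mR_pos P
  calc (P.tJ3 J : ℝ) ≤ ((2 * (P.T3 / 3 ^ (J + 1)) : ℕ) : ℝ) / mRp d := h1
    _ ≤ (2 * ((P.T3 : ℝ) / 3 ^ (J + 1))) / mRp d := div_le_div_of_nonneg_right h2 hm.le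
    _ = 2 * P.T3 / (3 ^ (J + 1) * mRp d) := by field_simp

omit P in
/-- `⌊a/b⌋ ≥ a/b − 1` for naturals, as reals. [folklore] -/
private theorem natDiv_ge_real' (a b : ℕ) (hb : 0 < b) : (a : ℝ) / b - 1 ≤ ((a / b : ℕ) : ℝ) := by
  have h := Nat.lt_div_mul_add hb (a := a)
  have hb' : (0 : ℝ) < b := by exact_mod_cast hb
  rw [div_sub_one hb'.ne', div_le_iff₀ hb']
  have : (a : ℝ) < (a / b : ℕ) * b + b := by exact_mod_cast h
  linarith

/-- `t_J ≥ 2T/(3^{J+1} · m) − 2` (real). [folklore] -/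
theorem tJ3_ge_real (J : ℕ) : 2 * (P.T3 : ℝ) / (3 ^ (J + 1) * mRp d) - 2 ≤ P.tJ3 J := by
  have hm := mR_pos P
  have h1 := natDiv_ge_real' (2 * (P.T3 / 3 ^ (J + 1))) (d + 1) (by omega)
  have h2 := natDiv_ge_real' P.T3 (3 ^ (J + 1)) (Nat.pow_pos (by norm_num))
  have em : ((d + 1 : ℕ) : ℝ) = mRp d := by unfold mRp; push_cast; ring
  rw [em] at h1
  push_cast at h1 h2
  unfold tJ3
  have h3 : (2 * ((P.T3 : ℝ) / 3 ^ (J + 1) - 1)) / mRp d ≤ ((2 * (P.T3 / 3 ^ (J + 1) : ℕ) : ℕ) : ℝ) / mRp d := by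
    push_cast
    exact div_le_div_of_nonneg_right (by linarith) hm.le
  have h4 : 2 * (P.T3 : ℝ) / (3 ^ (J + 1) * mRp d) - 2 ≤ (2 * ((P.T3 : ℝ) / 3 ^ (J + 1) - 1)) / mRp d - 1 := by
    rw [show 2 * (P.T3 : ℝ) / (3 ^ (J + 1) * mRp d) = (2 * ((P.T3 : ℝ) / 3 ^ (J + 1))) / mRp d by
      field_simp, mul_sub, sub_div]
    have : 2 * (1 : ℝ) / mRp d ≤ 1 := by
      rw [div_le_one hm]; linarith [two_le_mR P]
    linarith
  push_cast at h3
  linarith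

/-- `T ≥ 𝔘/(c_T W⋆) − 1` (real). [folklore] -/
theorem T3_ge_real : P.𝔘3 / (cTp * P.Wstarℓ) - 1 ≤ P.T3 := by
  have e : P.Uℓ / (cTp * 3 ^ (d + 1) * P.Wstarℓ) = P.𝔘3 / (cTp * P.Wstarℓ) := by
    rw [P.U_eq3]; unfold cTp; field_simp
  have h := P.T3_ge'
  rw [e] at h; exact h

/-! ### The interpolation nodes `kpts = #{s < 3^{k+J} S₀ : 3 ∤ s} = 2 · 3^{k+J} · ⌊c_S m nW⋆⌋` -/

/-- `kpts3 J k = 2 · 3^{k+J} · ⌊c_S m nW⋆⌋` exactly. [folklore] -/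
theorem kpts3_eq (J k : ℕ) : P.kpts3 J k = 2 * 3 ^ (k + J) * ⌊cSp * mRp d * P.nWstarℓ⌋₊ := by
  unfold kpts3; rw [P.S₀3_div_three]

/-- `kpts ≤ 2 · 3^{k+J} c_S m nW⋆` (real). [folklore] -/
theorem kpts3_le_real (J k : ℕ) : (P.kpts3 J k : ℝ) ≤ 2 * 3 ^ (k + J) * (cSp * mRp d * P.nWstarℓ) := by
  rw [P.kpts3_eq]; push_cast
  have := Nat.floor_le (show 0 ≤ cSp * mRp d * P.nWstarℓ by have := P.cS_mul_ge; linarith)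
  gcongr

/-- `kpts ≥ 2 · 3^{k+J} (c_S m nW⋆ − 1)` (real). [folklore] -/
theorem kpts3_ge_real (J k : ℕ) : 2 * 3 ^ (k + J) * (cSp * mRp d * P.nWstarℓ - 1) ≤ (P.kpts3 J k : ℝ) := by
  rw [P.kpts3_eq]; push_cast
  have := (Nat.lt_floor_add_one (cSp * mRp d * P.nWstarℓ)).le
  have h0 : (0 : ℝ) ≤ 2 * 3 ^ (k + J) := by positivity
  nlinarith

/-- `1 ≤ kpts`. [folklore] -/
theorem one_le_kpts3 (J k : ℕ) : 1 ≤ P.kpts3 J k := by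
  have h := P.kpts3_ge_real J k
  have hc := P.cS_mul_ge
  have h3 : (1 : ℝ) ≤ 3 ^ (k + J) := one_le_pow₀ (by norm_num)
  have : (1 : ℝ) ≤ P.kpts3 J k := by nlinarith
  exact_mod_cast this

/-- `kpts3 J k ≤ kpts3 J₀ d`-type monotonicity: `kpts ≤ 2 · 3^{d+J₀} · (S₀/3)` for `k ≤ d`, `J ≤ J₀`. [folklore] -/
theorem kpts3_le_nat {J k : ℕ} (hJ : J ≤ P.J₀3) (hk : k ≤ d) : P.kpts3 J k ≤ 2 * 3 ^ (d + P.J₀3) * (P.S₀3 / 3) := by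
  unfold kpts3
  exact Nat.mul_le_mul_right _ (Nat.mul_le_mul_left _ (Nat.pow_le_pow_right (by norm_num) (by omega)))

/-! ### KT₃: the Schwarz exponent of the inner steps and of the third step -/

/-- **Upper bound `kpts · t_J ≤ (8/3)·3ᵏ 𝔘/ℓ`** (`c_S/c_T = 2`; the `1/ℓ` of `S₀`).
[cite: Waldschmidt1980, Lemma 3.5 (p. 271)] [cite: Yu1989, §3 Lemma 3.3] -/
theorem KT3_le (J k : ℕ) : (P.kpts3 J k : ℝ) * (P.tJ3 J : ℝ) ≤ 8 / 3 * 3 ^ k * (P.𝔘3 / P.ℓ) := by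
  have h1 := P.kpts3_le_real J k
  have h2 := P.tJ3_le_real J
  have hm := mR_pos P; have hW := P.one_le_Wstar; have hT := P.T3_pos; have hTW := P.T3Wstar_le
  have hℓ := P.ℓ_pos
  have hW0 : 0 < P.Wstarℓ := by linarith
  have hcS0 : (0 : ℝ) < cSp := by unfold cSp; norm_num
  have enW : P.nWstarℓ = P.Wstarℓ / P.ℓ := rfl
  calc (P.kpts3 J k : ℝ) * (P.tJ3 J : ℝ)
      ≤ (2 * 3 ^ (k + J) * (cSp * mRp d * P.nWstarℓ)) * (2 * P.T3 / (3 ^ (J + 1) * mRp d)) :=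
        mul_le_mul h1 h2 (Nat.cast_nonneg _) (by have := P.one_le_nWstar; positivity)
    _ = 4 / 3 * 3 ^ k * cSp * (P.T3 * P.Wstarℓ) / P.ℓ := by
        rw [pow_add, pow_succ, enW]; field_simp; ring
    _ ≤ 4 / 3 * 3 ^ k * cSp * (P.𝔘3 / cTp) / P.ℓ := by gcongr
    _ = 8 / 3 * 3 ^ k * (P.𝔘3 / P.ℓ) := by unfold cSp cTp; field_simp; ring

/-- **Lower bound `kpts · t_J ≥ (31/32)·(8/3)·3ᵏ 𝔘/ℓ`** for `J < J₀`.
[cite: Waldschmidt1980, Lemma 3.5 (p. 271)] [cite: Yu1989, §3 Lemma 3.3] -/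
theorem KT3_ge {J : ℕ} (hJ : J < P.J₀3) (k : ℕ) :
    31 / 32 * (8 / 3 * 3 ^ k * (P.𝔘3 / P.ℓ)) ≤ (P.kpts3 J k : ℝ) * (P.tJ3 J : ℝ) := by
  have h1 := P.kpts3_ge_real J k
  have h2 := P.tJ3_ge_real J
  have h3 := P.T3_ge_real
  have hm := mR_pos P; have hm2 := two_le_mR P; have hW := P.one_le_Wstar; have hU := P.𝔘3_pos
  have hℓ := P.ℓ_pos; have hℓ1 := P.hℓ; have hℓW := P.ℓ_le_Wstar
  have hcS := P.cS_mul_ge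
  have hWU := P.Wstar_le_𝔘3
  -- the normalised unit `𝔘' = 𝔘/ℓ`
  set U' : ℝ := P.𝔘3 / P.ℓ with hU'
  have hU'0 : 0 < U' := by rw [hU']; positivity
  have enW : P.nWstarℓ = P.Wstarℓ / P.ℓ := rfl
  -- `3^{J} c_S m nW⋆ ≤ 𝔘'/2^{15}` : `3^{J} ≤ Lθ`, `Lθ S₀ ℓ ≤ 𝔘/2^14`, `S₀ ≥ 2 c_S m nW⋆`
  have hJL : (3 : ℝ) ^ J ≤ P.Lθ3 := by exact_mod_cast P.three_pow_le_Lθ3 hJ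
  have hLS : (P.Lθ3 : ℝ) * P.S₀3 ≤ U' / 2 ^ 14 := by
    have := P.Lθ3S₀3ℓ_le
    rw [le_div_iff₀ (by norm_num)] at this
    rw [hU', le_div_iff₀ (by norm_num), le_div_iff₀ hℓ]
    have e : (P.Lθ3 : ℝ) * P.S₀3 * 2 ^ 14 * P.ℓ = P.Lθ3 * P.S₀3 * P.ℓ * 2 ^ 14 := by ring
    linarith
  have hS₀ := P.S₀3_ge
  set Ap : ℝ := cSp * mRp d * P.nWstarℓ with hA
  have hA1 : 1 ≤ Ap := le_trans (by norm_num) hcS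
  have hsmall : (3 : ℝ) ^ J * Ap ≤ U' / 2 ^ 15 := by
    have : (3 : ℝ) ^ J * (2 * Ap) ≤ P.Lθ3 * P.S₀3 := mul_le_mul hJL hS₀ (by linarith) (Nat.cast_nonneg _)
    linarith
  have ht0 : (0 : ℝ) ≤ P.tJ3 J := Nat.cast_nonneg _
  -- `3^{J+1} t_J ≥ 2T/m − 2·3^{J+1}`
  have h3J : (0 : ℝ) < 3 ^ (J + 1) := by positivity
  have h2' : 2 * (P.T3 : ℝ) / mRp d - 2 * 3 ^ (J + 1) ≤ 3 ^ (J + 1) * (P.tJ3 J : ℝ) := by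
    have := mul_le_mul_of_nonneg_left h2 h3J.le
    have e : (3 : ℝ) ^ (J + 1) * (2 * P.T3 / (3 ^ (J + 1) * mRp d) - 2) = 2 * P.T3 / mRp d - 2 * 3 ^ (J + 1) := by
      field_simp
    linarith
  -- the main term: `Ap · 𝔘/(c_T W⋆) = 2 m 𝔘'`
  have eA : Ap * (P.𝔘3 / (cTp * P.Wstarℓ)) = 2 * mRp d * U' := by
    rw [hA, hU', enW]; unfold cSp cTp; field_simp
  have hmain : 31 / 32 * (4 * U') ≤ (Ap - 1) * (2 * P.T3 / mRp d - 2 * 3 ^ (J + 1)) := by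
    -- (a) `(Ap-1) · 2T/m ≥ (Ap-1) · 2(𝔘/(c_T W⋆) - 1)/m`
    have ha : (Ap - 1) * (2 * (P.𝔘3 / (cTp * P.Wstarℓ) - 1) / mRp d) ≤ (Ap - 1) * (2 * P.T3 / mRp d) := by
      refine mul_le_mul_of_nonneg_left ?_ (by linarith)
      rw [mul_div_assoc, mul_div_assoc]
      exact mul_le_mul_of_nonneg_left (div_le_div_of_nonneg_right h3 hm.le) (by norm_num)
    -- (b) expand
    have hb : (Ap - 1) * (2 * (P.𝔘3 / (cTp * P.Wstarℓ) - 1) / mRp d) =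
        2 * (2 * mRp d * U' - Ap - P.𝔘3 / (cTp * P.Wstarℓ) + 1) / mRp d := by
      rw [← eA]; ring
    -- (c) the pieces
    have hc1 : 2 * (2 * mRp d * U' - Ap - P.𝔘3 / (cTp * P.Wstarℓ) + 1) / mRp d =
        4 * U' - 2 * (Ap / mRp d) - 2 * (P.𝔘3 / (cTp * P.Wstarℓ) / mRp d) + 2 / mRp d := by
      field_simp; ring
    have hc2 : Ap / mRp d = cSp * P.nWstarℓ := by rw [hA]; field_simp
    have hc3 : P.𝔘3 / (cTp * P.Wstarℓ) / mRp d ≤ U' / 2 ^ 15 := by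
      have hden : P.ℓ * (2 : ℝ) ^ 15 ≤ cTp * P.Wstarℓ * mRp d := by unfold cTp; nlinarith
      calc P.𝔘3 / (cTp * P.Wstarℓ) / mRp d = P.𝔘3 / (cTp * P.Wstarℓ * mRp d) := div_div _ _ _
        _ ≤ P.𝔘3 / (P.ℓ * 2 ^ 15) := div_le_div_of_nonneg_left hU.le (by positivity) hden
        _ = U' / 2 ^ 15 := by rw [hU', div_div]
    have hc4 : 0 ≤ 2 / mRp d := by positivity
    have hWs : cSp * P.nWstarℓ ≤ U' / 2 ^ 81 := by
      rw [enW, hU']; unfold cSp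
      rw [show (2 : ℝ) ^ 15 * (P.Wstarℓ / P.ℓ) = (2 ^ 15 * P.Wstarℓ) / P.ℓ by ring,
        show P.𝔘3 / P.ℓ / 2 ^ 81 = (P.𝔘3 / 2 ^ 81) / P.ℓ by ring]
      exact div_le_div_of_nonneg_right (by linarith) hℓ.le
    -- (d) `(Ap-1) · 2 · 3^{J+1} ≤ 6 · 3^J Ap ≤ 6 𝔘'/2^15`
    have hd : (Ap - 1) * (2 * 3 ^ (J + 1)) ≤ 6 * (U' / 2 ^ 15) := by
      have h3J0 : (0 : ℝ) ≤ 3 ^ J := by positivity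
      have e : (Ap - 1) * (2 * 3 ^ (J + 1)) = 6 * (3 ^ J * Ap) - 6 * 3 ^ J := by rw [pow_succ]; ring
      rw [e]; linarith
    have htot : (Ap - 1) * (2 * P.T3 / mRp d - 2 * 3 ^ (J + 1)) =
        (Ap - 1) * (2 * P.T3 / mRp d) - (Ap - 1) * (2 * 3 ^ (J + 1)) := by ring
    rw [htot]
    have h31 : 4 * U' - 2 * (U' / 2 ^ 81) - 2 * (U' / 2 ^ 15) - 6 * (U' / 2 ^ 15) ≥ 31 / 32 * (4 * U') := by linarith
    linarith only [ha, hb, hc1, hc2, hc3, hc4, hWs, hd, h31]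
  -- positivity of the bracket, then the product bound
  have hX : 0 < 2 * (P.T3 : ℝ) / mRp d - 2 * 3 ^ (J + 1) := by
    by_contra hneg
    push Not at hneg
    have : (Ap - 1) * (2 * P.T3 / mRp d - 2 * 3 ^ (J + 1)) ≤ 0 := mul_nonpos_of_nonneg_of_nonpos (by linarith) hneg
    linarith [hU'0]
  have hk1 : 2 / 3 * 3 ^ k * (Ap - 1) * 3 ^ (J + 1) ≤ (P.kpts3 J k : ℝ) := by
    have : (2 : ℝ) / 3 * 3 ^ k * (Ap - 1) * 3 ^ (J + 1) = 2 * 3 ^ (k + J) * (Ap - 1) := by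
      rw [pow_add, pow_succ]; ring
    rw [this]; exact h1
  calc (31 : ℝ) / 32 * (8 / 3 * 3 ^ k * U') = 2 / 3 * 3 ^ k * (31 / 32 * (4 * U')) := by ring
    _ ≤ 2 / 3 * 3 ^ k * ((Ap - 1) * (2 * P.T3 / mRp d - 2 * 3 ^ (J + 1))) := by gcongr
    _ ≤ 2 / 3 * 3 ^ k * ((Ap - 1) * (3 ^ (J + 1) * (P.tJ3 J : ℝ))) := by
        have hA0 : 0 ≤ Ap - 1 := by linarith
        have h2k : (0 : ℝ) ≤ 2 / 3 * 3 ^ k := by positivity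
        exact mul_le_mul_of_nonneg_left (mul_le_mul_of_nonneg_left h2' hA0) h2k
    _ = (2 / 3 * 3 ^ k * (Ap - 1) * 3 ^ (J + 1)) * (P.tJ3 J : ℝ) := by ring
    _ ≤ (P.kpts3 J k : ℝ) * (P.tJ3 J : ℝ) := mul_le_mul_of_nonneg_right hk1 ht0

end PadicW80ParL

end Summit.ABC.StewartYu

end
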